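import Summits.AtomisticToContinuum.BoseEinsteinCondensation.Theorems.BECRichardsonGaudinRichardsonAnchorBECBornTrialState
import Summits.AtomisticToContinuum.BoseEinsteinCondensation.Theorems.BECRichardsonGaudinRichardsonAnchorBECPenalisedLowerBound
import Summits.AtomisticToContinuum.BoseEinsteinCondensation.Theorems.BECGroundStateSOSPeriodicIRBoundFsumCouplingSelect
import HarnessLib

/-!
# Crux `RichardsonAnchorBEC` (stmt-AtomisticToContinuum-14805) of route `BECRichardsonGaudin` — PROVED

`RichardsonAnchorBEC_proof : RichardsonAnchorBEC` — complete Bose–Einstein condensation, in the dilute limit, of the near-minimisers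
of the Richardson anchor functional `E_Δ(Φ) = ∫|∇Φ|² + Δ(N − n₀(Φ)) + (γ/L⁹)(N(N−1)/2)∫|∫∫conj(w_M)Φ|²`, `Δ = 2ργ`, on the torus
`L = (N/ρ)^{1/3}`: `∀ γ ≥ 0, Λ > 0, ε > 0 ∃ ρ₀ ∀ ρ < ρ₀ ∀ᶠ N ∃ δ > 0`, every `δ`-near-minimiser has `n₀ ≥ (1−ε)N`.

Proof (line `registered` of the crux, lead prover): the variational / Hellmann–Feynman inequality at fixed `N` between
* the UPPER bound `stub_bornTrialState` (Theorems/…BornTrialState.lean): `inf E_Δ ≤ e_ref + εργN`, `e_ref = bornEnergy = γρN/(2(1+γJ_M))`,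
  by the number-conserving, pair-number-windowed, infrared-cut Born trial state (second-Born renormalisation `γ → γ/(1+γJ_M)`), and
* the condensate-penalised LOWER bound `stub_penalisedLowerBound` (Theorems/…PenalisedLowerBound.lean): `E_Δ(Φ) + ϑργ·n₀(Φ) ≥
  e_ref + ϑργ(1−ε)N` for every `Φ`, by number-conserving sums of squares (`(P − sa₀²)†(P − sa₀²) ≥ 0`, `C_k†C_k ≥ 0`),
glued by `interacting_case` (`γ > 0`) and `free_case` (`γ = 0`: the free torus gas and the kinetic gap, from the tree), through
the definitional unfolding `RichardsonAnchorBEC_iff` (Theorems/…Defs.lean).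
-/

noncomputable section

namespace Summit.AtomisticToContinuum.BoseEinsteinCondensation.Cruxes.RichardsonAnchorBEC.Birth

open MeasureTheory Filter
open scoped ENNReal NNReal
open Literature.MathematicalPhysics.QuantumManyBody.BoseGas
open Summit.AtomisticToContinuum.BoseEinsteinCondensation.Theses.BECRichardsonGaudin

/-- **Base case `γ = 0` (the free torus gas), PROVED from the tree**: `inf E = E₀^per(0) = 0`
(`periodicGroundStateEnergy_zero_eq_zero`) and the kinetic gap `N ≤ n₀(Ψ) + (L/2π)² E(Ψ)`
(`CouplingSelect.natCast_le_condensateOccupation_add_energy`, packaged as `CouplingSelect.anchor`):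
with `δ = 4π²εN/L²` every `δ`-near-minimiser has `n₀ ≥ (1-ε)N`. [folklore] -/
theorem free_case (Λ ε : ℝ) (hε : 0 < ε) :
    ∃ ρ₀ : ℝ, 0 < ρ₀ ∧ ∀ ρ : ℝ, 0 < ρ → ρ < ρ₀ → ∀ᶠ n : ℕ in Filter.atTop, ∃ δ : ℝ≥0∞, 0 < δ ∧
      ∀ Ψ : PeriodicTrialState (n + 2) (sideLength ρ (n + 2)),
        anchorE 0 (2 * ρ * 0) ρ n Λ Ψ ≤ (⨅ Φ, anchorE 0 (2 * ρ * 0) ρ n Λ Φ) + δ →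
          ENNReal.ofReal ((1 - ε) * ((n + 2 : ℕ) : ℝ)) ≤
            condensateOccupation (n + 2) (sideLength ρ (n + 2)) Ψ.ψ := by
  refine ⟨1, one_pos, fun ρ hρ _ => Filter.Eventually.of_forall fun n => ?_⟩
  have hL : 0 < sideLength ρ (n + 2) := sideLength_succ_succ_pos hρ n
  obtain ⟨δ, hδ, h⟩ :=
    Summit.AtomisticToContinuum.BoseEinsteinCondensation.Cruxes.PeriodicIRBound.FsumPhasePencil.CouplingSelect.anchor
      (N := n + 2) (L := sideLength ρ (n + 2)) (by omega) hL (b := 1 - ε) (by linarith)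
      (0 : ℝ → ℝ≥0∞) rfl
  refine ⟨δ, hδ, fun Ψ hΨ => ENNReal.ofReal_le_of_le_toReal (h Ψ ?_)⟩
  have hinf : (⨅ Φ, anchorE 0 (2 * ρ * 0) ρ n Λ Φ) =
      periodicGroundStateEnergy 0 (n + 2) (sideLength ρ (n + 2)) := by
    simp only [anchorE_zero]
    rfl
  rw [← hinf, ← anchorE_zero ρ n Λ Ψ]
  exact hΨ

/-- **Interacting case `γ > 0` from the two landed halves `stub_bornTrialState` (upper) and `stub_penalisedLowerBound` (lower)** (the variational / Hellmann–Feynman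
inequality at fixed `N`, all in `ℝ≥0∞`): stub L at `(ε/3)` gives `ϑ` and, for every state,
`e_ref + λ(1-ε/3)N ≤ E_Δ(Ψ) + λ n₀(Ψ)` with `λ = ϑργ`; stub U at `εϑ/3` gives
`inf E_Δ ≤ e_ref + (εϑ/3)ργN`; for a `δ`-near-minimiser with `δ := (εϑ/3)ργN` the chain
`e_ref + λ(1-ε/3)N ≤ inf E_Δ + δ + λn₀ ≤ e_ref + 2δ + λn₀` cancels `e_ref` (finite) and leaves
`λ(1-ε)N ≤ λ n₀`, i.e. `(1-ε)N ≤ n₀`. [folklore] -/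
theorem interacting_case {γ Λ ε : ℝ} (hγ : 0 < γ) (hΛ : 0 < Λ) (hε : 0 < ε) :
    ∃ ρ₀ : ℝ, 0 < ρ₀ ∧ ∀ ρ : ℝ, 0 < ρ → ρ < ρ₀ → ∀ᶠ n : ℕ in Filter.atTop, ∃ δ : ℝ≥0∞, 0 < δ ∧
      ∀ Ψ : PeriodicTrialState (n + 2) (sideLength ρ (n + 2)),
        anchorE γ (2 * ρ * γ) ρ n Λ Ψ ≤ (⨅ Φ, anchorE γ (2 * ρ * γ) ρ n Λ Φ) + δ →
          ENNReal.ofReal ((1 - ε) * ((n + 2 : ℕ) : ℝ)) ≤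
            condensateOccupation (n + 2) (sideLength ρ (n + 2)) Ψ.ψ := by
  -- `ε ≥ 1`: the conclusion is `0 ≤ n₀`
  rcases le_or_gt 1 ε with hε1 | hε1
  · refine ⟨1, one_pos, fun ρ hρ _ => Filter.Eventually.of_forall fun n => ⟨1, one_pos, fun Ψ _ => ?_⟩⟩
    rw [ENNReal.ofReal_of_nonpos (mul_nonpos_of_nonpos_of_nonneg (by linarith) (by positivity))]
    exact bot_le
  -- `0 < ε < 1`
  obtain ⟨ϑ, hϑ, hL1⟩ := stub_penalisedLowerBound γ Λ hγ hΛ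
  obtain ⟨ρ₁, hρ₁, h₁⟩ := hL1 (ε / 3) (by positivity)
  obtain ⟨ρ₂, hρ₂, h₂⟩ := stub_bornTrialState γ Λ (ε * ϑ / 3) hγ hΛ (by positivity)
  refine ⟨min ρ₁ ρ₂, lt_min hρ₁ hρ₂, fun ρ hρ hρlt => ?_⟩
  filter_upwards [h₁ ρ hρ (hρlt.trans_le (min_le_left _ _)),
    h₂ ρ hρ (hρlt.trans_le (min_le_right _ _))] with n hLn hUn
  set N : ℕ := n + 2 with hN
  set lam : ℝ := ϑ * (ρ * γ) with hlam
  set b : ℝ := bornEnergy γ ρ n Λ with hb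
  set η : ℝ := ε * ϑ / 3 * (ρ * γ) * (N : ℝ) with hη
  have hlam0 : 0 < lam := by positivity
  have hNpos : (0 : ℝ) < N := by positivity
  have hb0 : 0 ≤ b := bornEnergy_nonneg hγ.le hρ n Λ
  have hη0 : 0 < η := by positivity
  have hA0 : 0 ≤ lam * (1 - ε / 3) * N := by
    have : 0 < 1 - ε / 3 := by linarith
    positivity
  refine ⟨ENNReal.ofReal η, ENNReal.ofReal_pos.2 hη0, fun Ψ hΨ => ?_⟩
  set n₀ : ℝ≥0∞ := condensateOccupation N (sideLength ρ N) Ψ.ψ with hn₀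
  have hLΨ := hLn Ψ
  have key : ENNReal.ofReal b + ENNReal.ofReal (lam * (1 - ε / 3) * N) ≤
      ENNReal.ofReal b + (ENNReal.ofReal η + ENNReal.ofReal η + ENNReal.ofReal lam * n₀) := by
    calc ENNReal.ofReal b + ENNReal.ofReal (lam * (1 - ε / 3) * N)
        = ENNReal.ofReal (b + lam * (1 - ε / 3) * N) := (ENNReal.ofReal_add hb0 hA0).symm
      _ ≤ anchorE γ (2 * ρ * γ) ρ n Λ Ψ + ENNReal.ofReal lam * n₀ := hLΨ
      _ ≤ (⨅ Φ, anchorE γ (2 * ρ * γ) ρ n Λ Φ) + ENNReal.ofReal η + ENNReal.ofReal lam * n₀ :=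
          add_le_add hΨ le_rfl
      _ ≤ ENNReal.ofReal b + ENNReal.ofReal η + ENNReal.ofReal η + ENNReal.ofReal lam * n₀ :=
          add_le_add (add_le_add hUn le_rfl) le_rfl
      _ = ENNReal.ofReal b + (ENNReal.ofReal η + ENNReal.ofReal η + ENNReal.ofReal lam * n₀) := by
          simp only [add_assoc]
  have key2 : ENNReal.ofReal (lam * (1 - ε / 3) * N) ≤
      ENNReal.ofReal η + ENNReal.ofReal η + ENNReal.ofReal lam * n₀ :=
    (ENNReal.add_le_add_iff_left ENNReal.ofReal_ne_top).1 key
  have key3 : ENNReal.ofReal (lam * (1 - ε / 3) * N - (η + η)) ≤ ENNReal.ofReal lam * n₀ := by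
    rw [ENNReal.ofReal_sub _ (by positivity), ENNReal.ofReal_add hη0.le hη0.le]
    exact tsub_le_iff_right.2 (key2.trans_eq (add_comm _ _))
  have hring : lam * (1 - ε / 3) * N - (η + η) = lam * ((1 - ε) * N) := by
    simp only [hlam, hη]
    ring
  rw [hring, ENNReal.ofReal_mul hlam0.le] at key3
  exact (ENNReal.mul_le_mul_iff_right (ENNReal.ofReal_pos.2 hlam0).ne' ENNReal.ofReal_ne_top).1 key3

/-- **THE CRUX `RichardsonAnchorBEC`, BY NAME**: complete BEC of the near-minimisers of the Richardson anchor in its dilute limit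
— unfold to `anchorE` (`RichardsonAnchorBEC_iff`), split `γ = 0` (`free_case`) / `γ > 0` (`interacting_case`). [folklore] -/
theorem RichardsonAnchorBEC_proof :
    Summit.AtomisticToContinuum.BoseEinsteinCondensation.Theses.BECRichardsonGaudin.RichardsonAnchorBEC := by
  refine RichardsonAnchorBEC_iff.mpr ?_
  intro γ Λ ε hγ hΛ hε
  rcases hγ.eq_or_lt with h | hγ'
  · subst h
    exact free_case Λ ε hε
  · exact interacting_case hγ' hΛ hε

end Summit.AtomisticToContinuum.BoseEinsteinCondensation.Cruxes.RichardsonAnchorBEC.Birth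

end
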